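import Summits.BirchSwinnertonDyer.BirchSwinnertonDyer.Theorems.AlignedTransportAtTwoMainConjectureOfRankZeroBSDAtTwoTwistSaturationParity
import Summits.BirchSwinnertonDyer.BirchSwinnertonDyer.Theorems.AlignedTransportAtTwoMainConjectureOfRankZeroBSDAtTwoOffStratumChi8Twist
import Literature.NumberTheory.EllipticCurves.QuadraticTwistSelmerPInfty
import HarnessLib

/-!
# Route `AlignedTransportAtTwo`, crux C2 `MainConjectureOfRankZeroBSDAtTwo` (stmt-BirchSwinnertonDyer-22298):
# THE PARITY DICHOTOMY WITH `hpar` DISCHARGED (modulo the printed 2-parity theorem and modularity) — on the `χ₈ = +1` half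
# (`Δ_min ≡ 1, 7 (mod 8)`) of the weight-`2` seed cell: `μ(X(W/ℚ_∞)) = 0 ∨ corank_{ℤ₂} Sel_{2^∞}(W⁽²⁾/ℚ) = 0`

HONEST FRAMING (cell `bsd-f1-sign2`, WIDTH-5 attached prover seat `bsd-line-att-p5` gen 46 on line `birth` of the lead `bsd-line-att-p2`;
`--supports` stmt-BirchSwinnertonDyer-22298, closes nothing; BSD is NOT proved by any of this; the crux C2, its verdict «blocked-on
`Rank1Residual.GreenbergMuConjectureIrreducible`» and every registered stub are untouched). THEOREMS ONLY — no `def`, no instance, no named fact, no `sorry`.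

Sequel of `…TwistSaturationParity` (p812562), whose dichotomy displayed `hpar : Even (corank_{ℤ₂} Sel_{2^∞}(W₂/ℚ))`. Here `hpar` is DISCHARGED from
PRINT: the 2-parity theorem (`∀ E, p_parity E 2` — Dokchitser–Dokchitser 2010 Thm. 1.4, `p = 2` Monsky 1996; tree named fact `p_parity`) and modularity
(`exists_isNewformOf`), through g32's kernel root-number law `w(W⁽²⁾) = w(W)` on `Δ_min ≡ 1, 7 (mod 8)` for `∏c` odd
(`…OffStratumChi8Twist.rootNumber_quadraticTwist_two_eq_self_of_minimalDiscriminantInt_emod_eight_eq_{one,seven}`) and `w(W) = +1` for `r_an(W) = 0`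
(tree `rootNumber_eq_one_of_even_analyticRank`), transported to any `ℚ`-model `W₂` by `selmerCorank_eq_of_variableChange`.

* `even_selmerCorank_twist_of_pParity` — `Δ_min ≡ 1, 7 (8)`, `∏c` odd, `r_an(W) = 0` ⟹ `Even (corank_{ℤ₂} Sel_{2^∞}(W₂/ℚ))` (mod 2-parity + modularity).
* ★★★ `mu_eq_zero_or_selmerCorank_twist_eq_zero_of_pParity` — **the dichotomy with NO parity binder left**: seed-cell `W` (`a₂ = +1`, no rational point of
  order `2`, `r_an = 0`, `BSD(W,2)`, `∏c` odd, `L`-value bit, `Δ_min ≡ 1,7 (8)`), PRINT {GZK, modularity, 2-parity} ⟹ for every normalised cyclotomic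
  datum **`μ(X(W/ℚ_∞)) = 0 ∨ corank_{ℤ₂} Sel_{2^∞}(W₂/ℚ) = 0`**: on this half of the cell Greenberg's `μ`-conjecture at `2` can fail only at seeds whose
  `√2`-twist has finite `2^∞`-Selmer group.

References: T. and V. Dokchitser, Ann. of Math. 172 (2010), Thm. 1.4 [DokchitserDokchitserAnnals2010]; P. Monsky, Math. Z. 221 (1996) [Monsky1996];
M. R. Murty, V. K. Murty, *Non-vanishing of L-functions* (1997), Ch. 6 §1 [MurtyMurty1997]; R. Greenberg, LNM 1716 (1999), Thm. 4.1 [GreenbergLNM1716].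
-/

set_option linter.dupNamespace false
set_option autoImplicit false

noncomputable section

open scoped Classical

namespace Summit.BirchSwinnertonDyer.BirchSwinnertonDyer.Theorems.AlignedTransportAtTwoTwistSaturation

open WeierstrassCurve Literature.NumberTheory.EllipticCurves
  Literature.NumberTheory.EllipticCurves.ModularForms
  Literature.NumberTheory.EllipticCurves.Rank1Residual
  Literature.NumberTheory.EllipticCurves.Greenberg1999
  Summit.BirchSwinnertonDyer.Rank1Residual
  Summit.BirchSwinnertonDyer.Rank1Residual.X5
  Summit.BirchSwinnertonDyer.Rank1Residual.Iwasawa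
  Summit.BirchSwinnertonDyer.BirchSwinnertonDyer.Theorems.Rank1ResidualX1Defs
  Summit.BirchSwinnertonDyer.BirchSwinnertonDyer.Theorems.AlignedTransportAtTwoOffStratumChi8Twist

variable (W W₂ : WeierstrassCurve ℚ) [W.IsElliptic] [W.IsGloballyMinimal] [W₂.IsElliptic] {V : VariableChange ℚ}
  (hV : V • W₂ = W.quadraticTwist 2)

include hV in
omit [W₂.IsElliptic] in
/-- **`Even (corank_{ℤ₂} Sel_{2^∞}(W₂/ℚ))` on the `χ₈ = +1` half**, modulo PRINT {2-parity for all elliptic curves over `ℚ` (`hDD`), modularity (`hmod'`)}: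
`w(W⁽²⁾) = w(W)` (g32, `Δ_min ≡ 1, 7 (8)`, `∏c` odd, good at `2`), `w(W) = +1` (`r_an(W) = 0`), `(−1)^{corank} = w` (2-parity for the twist), corank invariant
under the change of model `V`. [cite: DokchitserDokchitserAnnals2010, Thm. 1.4] [cite: MurtyMurty1997, Ch. 6 §1] -/
theorem even_selmerCorank_twist_of_pParity (hmod' : exists_isNewformOf)
    (hDD : ∀ (E : WeierstrassCurve ℚ) [E.IsElliptic], p_parity E 2)
    (hgood : W.HasGoodReductionAtPrime 2) (htam : Odd W.tamagawaProduct)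
    (hΔ : minimalDiscriminantInt W % 8 = 1 ∨ minimalDiscriminantInt W % 8 = 7) (hr : W.analyticRank = 0) :
    Even (W₂.selmerCorank 2) := by
  haveI : (W.quadraticTwist (2 : ℚ)).IsElliptic := W.isElliptic_quadraticTwist two_ne_zero
  have hwW : W.rootNumber = 1 := rootNumber_eq_one_of_even_analyticRank (W := W) (by rw [hr]; exact Even.zero)
  have hw2 : (W.quadraticTwist 2).rootNumber = 1 := by
    rcases hΔ with h1 | h7
    · rw [rootNumber_quadraticTwist_two_eq_self_of_minimalDiscriminantInt_emod_eight_eq_one W hmod' hgood htam h1, hwW]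
    · rw [rootNumber_quadraticTwist_two_eq_self_of_minimalDiscriminantInt_emod_eight_eq_seven W hmod' hgood htam h7, hwW]
  have hpar : (-1 : ℤ) ^ (W.quadraticTwist (2 : ℚ)).selmerCorank 2 = (W.quadraticTwist (2 : ℚ)).rootNumber := hDD _
  rw [hw2] at hpar
  rw [selmerCorank_eq_of_variableChange 2 hV]
  exact (neg_one_pow_eq_one_iff_even (by norm_num)).mp hpar

include hV in
/-- ★★★ **THE PARITY DICHOTOMY, `hpar` DISCHARGED.** `W` globally minimal, good ordinary at `2` with `#Ẽ(𝔽₂) = 2` (`a₂ = +1`), no rational point of order `2`,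
`r_an(W) = 0`, `BSD(W,2)`, `∏c_ℓ` odd, `L(W,1)/Ω_W = q` (`q ≠ 0`, `ord₂ q = 0`), `Δ_min ≡ 1, 7 (mod 8)` (the `χ₈ = +1` half); PRINT {GZK `hGZK`, modularity `hmod'`,
2-parity `hDD`}; `W₂` any `ℚ`-model of `W⁽²⁾`. Then for EVERY normalised cyclotomic dual datum: **`μ(X(W/ℚ_∞)) = 0 ∨ corank_{ℤ₂} Sel_{2^∞}(W₂/ℚ) = 0`.**
[cite: DokchitserDokchitserAnnals2010, Thm. 1.4] [cite: GreenbergLNM1716, Thm. 4.1 (p. 102), §4 p. 107] [cite: Miller2011LMS, Def. 1.1] [cite: MurtyMurty1997, Ch. 6 §1] -/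
theorem mu_eq_zero_or_selmerCorank_twist_eq_zero_of_pParity (hGZK : rank_eq_analyticRank_of_analyticRank_le_one)
    (hmod' : exists_isNewformOf) (hDD : ∀ (E : WeierstrassCurve ℚ) [E.IsElliptic], p_parity E 2)
    (hord : IsOrdinaryAt W 2) (ha : W.reductionPointCount 2 = 2) (ht : ∀ x : ℚ, ¬ HasRationalTwoTorsionX W x) (hr : W.analyticRank = 0)
    (hbsd : BSDp W 2) (htam : Odd W.tamagawaProduct)
    (hL : ∃ q : ℚ, q ≠ 0 ∧ W.entireLFunction 1 / (W.realPeriodRat : ℂ) = (q : ℂ) ∧ padicValRat 2 q = 0)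
    (hΔ : minimalDiscriminantInt W % 8 = 1 ∨ minimalDiscriminantInt W % 8 = 7)
    (κ : ZpExtension ℚ 2) {γ : Field.absoluteGaloisGroup ℚ} (hκ : κ.IsCyclotomic) (hγ : κ.IsTopGenerator γ)
    (hγ' : IsCyclotomicVariable 2 γ) (D : W.SelmerDualData κ γ) :
    D.mu = 0 ∨ W₂.selmerCorank 2 = 0 :=
  mu_eq_zero_or_selmerCorank_twist_eq_zero_of_lValue_of_even W W₂ hV hGZK hord ha ht hr hbsd htam hL
    (even_selmerCorank_twist_of_pParity W W₂ hV hmod' hDD ((isOrdinaryAt_iff W 2).mp hord).1 htam hΔ hr) κ hκ hγ hγ' D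

end Summit.BirchSwinnertonDyer.BirchSwinnertonDyer.Theorems.AlignedTransportAtTwoTwistSaturation

end
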